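import Literature.NumberTheory.EllipticCurves.IsogenyDeterminantProofs
import Literature.NumberTheory.EllipticCurves.IsogenyDualFiniteFieldProofs
import Literature.NumberTheory.EllipticCurves.FrobeniusTwist
import Mathlib.FieldTheory.PurelyInseparable.Exponent
import HarnessLib

/-!
# Factorisation of an isogeny through the Frobenius (Silverman, *AEC*, Cor. II.2.12)

Topic `NumberTheory/EllipticCurves` (trunk T-ELLARITH); notion `cm_endomorphisms_isogeny`.
A *proofs* file (theorems only, D-0014 append protocol) over the prelude
`Literature.NumberTheory.EllipticCurves.Isogeny`, on top of the tree's
`IsogenySeparableFactorProofs` (Cor. III.4.11 and the dual of a **separable** isogeny in any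
characteristic), `IsogenyDualFiniteFieldProofs` (Cor. III.4.11 from the inclusion of function
fields, `Isogeny.exists_eq_comp_of_pullback_mem_pullbackField`; isogeny is symmetric over a
finite field), `IsogenyDeterminantProofs` (`deg (ψ ∘ φ) = deg ψ · deg φ`) and `FrobeniusTwist`
(the `p^n`-power Frobenius `Frob : E → E^{(p^n)}` with `Frob^* K̄(E^{(p^n)}) = K̄(E)^{p^n}`,
`deg Frob = p^n`). It proves, for isogenies of elliptic curves over an **arbitrary** field `K`
of exponential characteristic `p`:

* **Cor. II.2.12** — `WeierstrassCurve.Isogeny.exists_eq_comp_frobeniusTwistIsogeny`: every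
  isogeny `φ : E → E'` over `K` factors as `φ = λ ∘ Frob_q`, `q = p^r = deg_i φ` the inseparable
  degree, with `λ : E^{(q)} → E'` an isogeny over `K` which is **separable**
  (`deg λ = #ker λ = #ker φ = deg_s φ`). The field-theoretic heart is
  `restrictScalars_separableClosure_pullbackField_eq`: the separable closure of `φ^* K̄(E')` in
  `K̄(E)` is `K̄(E)^q = Frob_q^* K̄(E^{(q)})` (Silverman's proof of II.2.12 with Prop. II.2.11:
  the purely inseparable extension `K̄(E)/S` of degree `q` is `K̄(E)/K̄(E)^q`).
* `WeierstrassCurve.Isogeny.exists_isogeny_frobeniusTwist`: hence an isogeny `E' → E^{(q)}`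
  over `K` (the dual of the separable factor, *AEC* Thm. III.6.1(a) via the tree's
  `Isogeny.nonempty_symm_of_deg_le_card_ker`). Over a finite field `k` (`#k = p^d`,
  `E^{(p^{dN})} = E`) a further Frobenius turns this into `E' → E`; that statement is the tree's
  `Isogeny.nonempty_symm_of_finite` (`IsogenyDualFiniteFieldProofs`, by a different route), so it
  is not repeated here. Over an arbitrary field, `E^{(q)} → E` (the Verschiebung) would follow
  from II.2.12 applied to `[p^r]` once `[p]` is known to be inseparable in characteristic `p`
  (*AEC* III.6.4(c) / Cor. III.5.5), which the tree does not have.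

## The argument (Silverman, proof of Cor. II.2.12)

Let `F = K̄(E)`, `L = φ^* K̄(E') ⊆ F` (finite, Thm. II.2.4(a), the tree's
`finiteDimensional_pullbackField_holds`), `S` the separable closure of `L` in `F`; `F/S` is
purely inseparable of degree `deg_i φ = p^r` (Mathlib `Field.finInsepDegree`,
`finInsepDegree_eq_pow`). Every `w ∈ F` has minimal polynomial `X^{p^e} - c` over `S` with
`p^e ≤ [F : S] = p^r` (Mathlib `IsPurelyInseparable.minpoly_natDegree_eq'`,
`minpoly.natDegree_le`), so `w^{p^r} ∈ S`: `F^{p^r} ⊆ S`, and `[F : F^{p^r}] = p^r`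
(Prop. II.2.11(b), the tree's `finrank_pullbackField_frobeniusTwistIsogeny`) forces
`S = F^{p^r} = Frob^* K̄(E^{(p^r)})` (II.2.11(a), `mem_pullbackField_frobeniusTwistIsogeny_iff`).
Hence `φ^* x', φ^* y' ∈ L ⊆ Frob^* K̄(E^{(p^r)})`, and since `Frob` is a bijection on `K̄`-points
the map `λ(Frob P) := φ P` is an isogeny with `φ = λ ∘ Frob` (Cor. III.4.11 from the inclusion
of function fields). Finally `deg φ = deg λ · p^r` (tower law) and
`deg φ = deg_s φ · deg_i φ = #ker φ · p^r` (Thm. III.4.10(a), the tree's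
`card_ker_eq_finSepDegree_holds`) give `deg λ = #ker φ = #ker λ`.

## References

* [SilvermanAEC2009] J. H. Silverman, *The Arithmetic of Elliptic Curves*, 2nd ed., GTM 106,
  Springer 2009: II.§2 (Thm. II.2.4, Prop. II.2.11, **Cor. II.2.12**, pp. 20–25), Cor. III.4.11,
  Thm. III.4.10, Thm. III.6.1 (its proof: "the general isogeny is the composition of a separable
  isogeny and a Frobenius morphism").

## Design

`noncomputable section`, `open scoped Classical`, `K : Type u`, dot-notation extensions in
`namespace WeierstrassCurve.Isogeny` as in the files built upon; the exponential characteristic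
is an explicit `(p : ℕ) [ExpChar K p]` as in `FrobeniusTwist`. Theorems only, no definitions.
-/

noncomputable section

open scoped Classical

universe u

namespace WeierstrassCurve

variable {K : Type u} [Field K] {W W' : WeierstrassCurve K}

/-! ## Silverman, *AEC*, Cor. II.2.12: the separable closure of `φ^* K̄(E')` is `K̄(E)^{p^r}` -/

section FrobeniusFactor

variable (p : ℕ) [ExpChar K p]

attribute [local instance] expChar_algebraicClosure expChar_geomFunctionField

namespace Isogeny

variable [W.IsElliptic] [W'.IsElliptic] (φ : Isogeny W W')

/-- **The inseparable degree `deg_i φ = [K̄(E) : φ^* K̄(E')]_i` of an isogeny is a power `p^r` of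
the exponential characteristic** (Mathlib's `Field.finInsepDegree`, the degree of `K̄(E)` over
the separable closure of `φ^* K̄(E')`, which is a purely inseparable finite extension).
Silverman, *AEC*, II.§2 (p. 21: `deg_i φ`), Cor. II.2.12. [folklore] -/
theorem exists_finInsepDegree_pullbackField_eq_pow :
    ∃ r : ℕ, Field.finInsepDegree φ.pullbackField W.geomFunctionField = p ^ r := by
  haveI : FiniteDimensional φ.pullbackField W.geomFunctionField :=
    finiteDimensional_pullbackField_holds W W' φ
  haveI : ExpChar φ.pullbackField p :=
    expChar_of_injective_algebraMap (algebraMap (AlgebraicClosure K) φ.pullbackField).injective p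
  exact finInsepDegree_eq_pow _ _ p

/-- **`deg φ = #ker φ · deg_i φ`** (`deg = deg_s · deg_i` with `deg_s φ = #ker φ`, Silverman,
*AEC*, II.§2 and Thm. III.4.10(a); Mathlib `Field.finSepDegree_mul_finInsepDegree` and the
tree's `card_ker_eq_finSepDegree_holds`). [cite: SilvermanAEC2009, Thm. III.4.10(a)] -/
theorem card_ker_mul_finInsepDegree_eq_deg :
    Nat.card φ.toAddMonoidHom.ker * Field.finInsepDegree φ.pullbackField W.geomFunctionField =
      φ.deg := by
  rw [card_ker_eq_finSepDegree_holds W W' φ, Isogeny.deg, Field.finSepDegree_mul_finInsepDegree]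

/-- **The separable closure of `φ^* K̄(E')` in `K̄(E)` is `K̄(E)^{p^r} = Frob_{p^r}^* K̄(E^{(p^r)})`,
`p^r = deg_i φ`** (the heart of Silverman's proof of Cor. II.2.12): `K̄(E)` is purely inseparable
of degree `p^r` over the separable closure `S`, so every `w ∈ K̄(E)` has minimal polynomial
`X^{p^e} - c` over `S` with `p^e ≤ p^r`, whence `w^{p^r} ∈ S`, i.e. `K̄(E)^{p^r} ⊆ S`; and
`[K̄(E) : K̄(E)^{p^r}] = p^r = [K̄(E) : S]` (Prop. II.2.11(b)). Here `K̄(E)^{p^r}` is written as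
`Frob^* K̄(E^{(p^r)})` (Prop. II.2.11(a), the tree's `mem_pullbackField_frobeniusTwistIsogeny_iff`),
and `S` is viewed over `K̄` (`IntermediateField.restrictScalars`).
[cite: SilvermanAEC2009, Cor. II.2.12 (proof) with Prop. II.2.11] -/
theorem restrictScalars_separableClosure_pullbackField_eq {r : ℕ}
    (hr : Field.finInsepDegree φ.pullbackField W.geomFunctionField = p ^ r) :
    (separableClosure φ.pullbackField W.geomFunctionField).restrictScalars (AlgebraicClosure K) =
      (W.frobeniusTwistIsogeny p r).pullbackField := by
  set L := φ.pullbackField with hL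
  set S := separableClosure L W.geomFunctionField with hS
  haveI : FiniteDimensional L W.geomFunctionField := finiteDimensional_pullbackField_holds W W' φ
  haveI : FiniteDimensional (W.frobeniusTwistIsogeny p r).pullbackField W.geomFunctionField :=
    finiteDimensional_pullbackField_holds W _ _
  haveI : ExpChar L p :=
    expChar_of_injective_algebraMap (algebraMap (AlgebraicClosure K) L).injective p
  haveI : ExpChar S p := expChar_of_injective_algebraMap (algebraMap L S).injective p
  haveI : Module.Free S W.geomFunctionField := Module.Free.of_divisionRing S _
  -- `[F : S] = p ^ r`
  have hfr : Module.finrank S W.geomFunctionField = p ^ r := hr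
  -- `K̄(E)^{p^r} ⊆ S`
  have hle : (W.frobeniusTwistIsogeny p r).pullbackField ≤ S.restrictScalars (AlgebraicClosure K) := by
    intro z hz
    rw [IntermediateField.mem_restrictScalars]
    obtain ⟨w, rfl⟩ := (W.mem_pullbackField_frobeniusTwistIsogeny_iff p r z).mp hz
    have he : p ^ IsPurelyInseparable.elemExponent S w ≤ p ^ r := by
      rw [← IsPurelyInseparable.minpoly_natDegree_eq' S p w, ← hfr]
      exact minpoly.natDegree_le w
    have hmem : w ^ p ^ IsPurelyInseparable.elemExponent S w ∈ S := by
      obtain ⟨y, hy⟩ := IsPurelyInseparable.elemExponent_def' S p w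
      rw [← hy]
      exact y.2
    rcases ‹ExpChar K p› with _ | ⟨hp⟩
    · simpa using hmem
    · have hle' : IsPurelyInseparable.elemExponent S w ≤ r :=
        (Nat.pow_le_pow_iff_right hp.one_lt).mp he
      have hw : w ^ p ^ r = (w ^ p ^ IsPurelyInseparable.elemExponent S w) ^
          p ^ (r - IsPurelyInseparable.elemExponent S w) := by
        rw [← pow_mul, ← pow_add, Nat.add_sub_cancel' hle']
      rw [hw]
      exact pow_mem hmem _
  -- equal codegrees
  refine (IntermediateField.eq_of_le_of_finrank_le' hle ?_).symm
  rw [W.finrank_pullbackField_frobeniusTwistIsogeny p r]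
  exact hfr.ge

/-- **`φ^* K̄(E') ⊆ K̄(E)^{p^r} = Frob_{p^r}^* K̄(E^{(p^r)})`, `p^r = deg_i φ`** (`φ^* K̄(E')`
lies in its separable closure). Silverman, *AEC*, proof of Cor. II.2.12.
[cite: SilvermanAEC2009, Cor. II.2.12 (proof)] -/
theorem pullbackField_le_pullbackField_frobeniusTwistIsogeny {r : ℕ}
    (hr : Field.finInsepDegree φ.pullbackField W.geomFunctionField = p ^ r) :
    φ.pullbackField ≤ (W.frobeniusTwistIsogeny p r).pullbackField := by
  rw [← φ.restrictScalars_separableClosure_pullbackField_eq p hr]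
  exact le_restrictScalars_separableClosure φ.pullbackField

/-- **Silverman, *AEC*, Cor. II.2.12: every isogeny factors as a Frobenius followed by a
separable isogeny.** For an isogeny `φ : E → E'` of elliptic curves over a field `K` of
exponential characteristic `p`, with inseparable degree `deg_i φ = p^r`, there is an isogeny
`λ : E^{(p^r)} → E'` over `K` with `φ = λ ∘ Frob_{p^r}`; moreover `deg λ = #ker φ` (`= deg_s φ`)
and `#ker λ = #ker φ`, so that `λ` is separable (`deg λ = #ker λ`, Thm. III.4.10(c)).
*Proof.* `φ^* x', φ^* y' ∈ Frob^* K̄(E^{(p^r)})` (`pullbackField_le_pullbackField_frobeniusTwistIsogeny`)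
and `Frob` is a bijection on `K̄`-points, so `λ(Frob P) := φ P` is the required isogeny
(the tree's `exists_eq_comp_of_pullback_mem_pullbackField`, Cor. III.4.11 from the inclusion of
function fields); the degrees by the tower law
`deg φ = deg λ · deg Frob = deg λ · p^r` and `deg φ = #ker φ · p^r`.
[cite: SilvermanAEC2009, Cor. II.2.12] -/
theorem exists_eq_comp_frobeniusTwistIsogeny :
    ∃ (r : ℕ) (lam : Isogeny (W.frobeniusTwist p r) W'),
      Field.finInsepDegree φ.pullbackField W.geomFunctionField = p ^ r ∧
      φ = lam.comp (W.frobeniusTwistIsogeny p r) ∧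
      lam.deg = Nat.card φ.toAddMonoidHom.ker ∧
      Nat.card lam.toAddMonoidHom.ker = Nat.card φ.toAddMonoidHom.ker := by
  obtain ⟨r, hr⟩ := φ.exists_finInsepDegree_pullbackField_eq_pow p
  have hL := φ.pullbackField_le_pullbackField_frobeniusTwistIsogeny p hr
  have hx : φ.pullbackX ∈ (W.frobeniusTwistIsogeny p r).pullbackField :=
    hL (IntermediateField.subset_adjoin _ _ (Set.mem_insert _ _))
  have hy : φ.pullbackY ∈ (W.frobeniusTwistIsogeny p r).pullbackField :=
    hL (IntermediateField.subset_adjoin _ _ (Set.mem_insert_of_mem _ (Set.mem_singleton _)))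
  obtain ⟨lam, hlam⟩ := (W.frobeniusTwistIsogeny p r).exists_eq_comp_of_pullback_mem_pullbackField
    (W.frobeniusTwistIsogeny_surjective p r) φ (fun P hP ↦ by
      rw [frobeniusTwistIsogeny_apply, frobeniusTwistMap_eq_zero_iff] at hP
      rw [hP, map_zero]) hx hy
  have hcomp : φ = lam.comp (W.frobeniusTwistIsogeny p r) := Isogeny.ext fun P ↦ by
    rw [comp_apply, hlam P]
  -- the kernels correspond under the bijection `Frob`
  have hker : Nat.card lam.toAddMonoidHom.ker = Nat.card φ.toAddMonoidHom.ker := by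
    refine (Nat.card_congr (Equiv.ofBijective
      (fun P : φ.toAddMonoidHom.ker ↦ (⟨W.frobeniusTwistIsogeny p r P, ?_⟩ : lam.toAddMonoidHom.ker))
      ⟨?_, ?_⟩)).symm
    · have hP : φ P = 0 := P.2
      change lam (W.frobeniusTwistIsogeny p r P) = 0
      rw [← hlam, hP]
    · intro P Q hPQ
      exact Subtype.ext (W.frobeniusTwistMap_injective p r (congrArg Subtype.val hPQ))
    · rintro ⟨Q, hQ⟩
      obtain ⟨P, rfl⟩ := W.frobeniusTwistIsogeny_surjective p r Q
      have hP : φ P = 0 := by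
        rw [hlam P]
        exact hQ
      exact ⟨⟨P, hP⟩, rfl⟩
  -- the degrees
  have hdeg : lam.deg = Nat.card φ.toAddMonoidHom.ker := by
    have h1 := φ.card_ker_mul_finInsepDegree_eq_deg
    rw [hr, hcomp, deg_comp, deg_frobeniusTwistIsogeny, ← hcomp] at h1
    exact (Nat.eq_of_mul_eq_mul_right (expChar_pow_pos K p r) h1).symm
  exact ⟨r, lam, hr, hcomp, hdeg, hker⟩

/-- **An isogeny `E → E'` over `K` yields an isogeny `E' → E^{(p^r)}` over `K`, `p^r` its
inseparable degree**: the dual of the separable factor `λ` of `φ = λ ∘ Frob_{p^r}`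
(Cor. II.2.12 with Thm. III.6.1(a) for separable isogenies, the tree's
`Isogeny.nonempty_symm_of_deg_le_card_ker`). Silverman, *AEC*, proof of Thm. III.6.1 ("the
general isogeny is the composition of a separable isogeny and a Frobenius morphism").
[cite: SilvermanAEC2009, Thm. III.6.1 (proof) with Cor. II.2.12] -/
theorem exists_isogeny_frobeniusTwist :
    ∃ r : ℕ, Field.finInsepDegree φ.pullbackField W.geomFunctionField = p ^ r ∧
      Nonempty (Isogeny W' (W.frobeniusTwist p r)) := by
  obtain ⟨r, lam, hr, -, hdeg, hker⟩ := φ.exists_eq_comp_frobeniusTwistIsogeny p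
  exact ⟨r, hr, lam.nonempty_symm_of_deg_le_card_ker (by rw [hdeg, hker])⟩

end Isogeny

end FrobeniusFactor

end WeierstrassCurve
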